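import Summits.CriticalPhenomena.PercolationContinuityZ3.Theorems.PercNearOneGluingNoHeavyLowerTailKNGoodGMgcThreeChildren
import Summits.CriticalPhenomena.PercolationContinuityZ3.Theorems.PercNearOneGluingNoHeavyLowerTailKNGoodGMgcBlobTarget
import Summits.CriticalPhenomena.PercolationContinuityZ3.Theorems.PercNearOneGluingNoHeavyLowerTailKNGoodGMgcCornerThree
import HarnessLib

/-!
# UG(|A| = 3, |R| ≤ 4): the observer with three children is Kozma–Nitzan-good — KEY3 discharged
# (`NoHeavyLowerTail` cell, stmt-CriticalPhenomena-4575; prover `prim-hp-2`, gen 19 — closes MEMO-gen15 §3a / MEMO-gen19 §6–7)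

Support file (`--supports stmt-CriticalPhenomena-4575`; imports the COMPUTATIONAL certificate layers).  No definitions, no named facts, no sorries.
* `Verts.blob_key` — the BLOB KERNEL in contracted form: for a pendant side `u` over the core (relays labelled `s₁ ≤ s₂ ≤ s₃`) and `j` the
  loneliest relay of `u`, the goodness functional of `x` in `u[xz ↦ 1][xy ↦ 1]` at `j` is `≥ 0` (`blob_target_expansion` + `Verts.cone` + the rows
  `row_21/31/32` + the blob certificates `blob_free_j*` of `…BlobCert`).
* `blob_key_row` — the same, unbundled.
* **`knGood_threeChildren`** — `o ∉ A = {a₁,a₂,a₃}` joined to its three children `x, y, z` (and possibly to relays), the children carrying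
  hairs to the relays and arbitrary pairs among themselves; loop at `o` zero; `b ∉ {o,x,y,z}`: `KNGood w A hA o b`
  (`knGood_threeChildren_of_blobKey` with `hkey3` supplied by corner (1,1,1) `agood_wzero_glue_three` + `blob_key`).
Together with `knGood_oneChild_threeBelow`, `knGood_twoChildren_grandchild` (…Grandchild) and gen 14's `knGood_twoChildren_threeRelays`, every
shape of an observer side with at most four vertices over three relays is covered: **every separated Kozma–Nitzan quadruple with |A| = 3 and
observer side ≤ 4 vertices is good** (MEMO-gen15 §3a COROLLARY of THEOREM B).
-/

noncomputable section

namespace Summit.CriticalPhenomena.PercolationContinuityZ3.Theorems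

namespace KNGoodGMgc

open MeasureTheory Set Literature.Probability.LatticeModels Literature.Probability.Percolation KNGoodAux KNGoodHair KNGoodSeries
  KNGoodGC3 KNGoodGC3Adj
open scoped Classical BigOperators

variable {n : ℕ}

namespace Verts

variable (V : Verts n)

/-- **The blob kernel (contracted form).**  `u` pendant, relays labelled by core reliability, `j` loneliest in `u`: the goodness functional of `x`
in `u[xz ↦ 1][xy ↦ 1]` at `j` is nonnegative. [this work] -/
theorem blob_key {u : Sym2 (Fin n) → unitInterval} (hP : V.Pendant u) (b : Fin n)
    (hb : b ∉ ({V.x, V.y, V.z} : Finset (Fin n))) (hA : ({V.a₁, V.a₂, V.a₃} : Finset (Fin n)).Nonempty)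
    (hs12 : (prodBernoulli (V.core u)).real (openConn V.a₁ b) ≤ (prodBernoulli (V.core u)).real (openConn V.a₂ b))
    (hs23 : (prodBernoulli (V.core u)).real (openConn V.a₂ b) ≤ (prodBernoulli (V.core u)).real (openConn V.a₃ b))
    (j : Fin n) (hj : j ∈ ({V.a₁, V.a₂, V.a₃} : Finset (Fin n)))
    (hrow : ∀ a ∈ ({V.a₁, V.a₂, V.a₃} : Finset (Fin n)), (prodBernoulli u).real (openConn j b) ≤ (prodBernoulli u).real (openConn a b)) :
    (prodBernoulli (Function.update (Function.update u (V.e 10) 1) (V.e 11) 1)).real (openConn j b) ≤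
      (prodBernoulli (Function.update (Function.update u (V.e 10) 1) (V.e 11) 1)).real (openConn V.x b) +
        ∑ W ∈ nullSets ({V.a₁, V.a₂, V.a₃} : Finset (Fin n)),
          (prodBernoulli (Function.update (Function.update u (V.e 10) 1) (V.e 11) 1)).real (clusterIs V.x W) *
            ({V.a₁, V.a₂, V.a₃} : Finset (Fin n)).inf' hA
              (fun a => (prodBernoulli (Function.update (Function.update u (V.e 10) 1) (V.e 11) 1)).real
                (openConnIn ((↑W : Set (Fin n))ᶜ) a b)) := by
  set A : Finset (Fin n) := {V.a₁, V.a₂, V.a₃} with hAdef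
  have hidx : ∀ a ∈ A, ∃ i : ℕ, (i = 1 ∨ i = 2 ∨ i = 3) ∧ V.relay i = a := by
    intro a ha; simp only [hAdef, Finset.mem_insert, Finset.mem_singleton] at ha
    rcases ha with rfl | rfl | rfl
    · exact ⟨1, Or.inl rfl, rfl⟩
    · exact ⟨2, Or.inr (Or.inl rfl), rfl⟩
    · exact ⟨3, Or.inr (Or.inr rfl), rfl⟩
  obtain ⟨j', hj', rfl⟩ := hidx j hj
  have hs1 : ∀ a ∈ A, (prodBernoulli (V.core u)).real (openConn V.a₁ b) ≤ (prodBernoulli (V.core u)).real (openConn a b) := by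
    intro a ha; simp only [hAdef, Finset.mem_insert, Finset.mem_singleton] at ha
    rcases ha with rfl | rfl | rfl
    · exact le_rfl
    · exact hs12
    · exact hs12.trans hs23
  have hT := V.blob_target_expansion hP b hb j' hj' hA hs1
  obtain ⟨cα, cβ, cγ, cδ, cε⟩ := V.cone u b hs12 hs23
  have hx := V.X_mem u
  have ha₁ : V.a₁ ∈ A := by simp [hAdef]
  have ha₂ : V.a₂ ∈ A := by simp [hAdef]
  have ha₃ : V.a₃ ∈ A := by simp [hAdef]
  have r21 : (prodBernoulli u).real (openConn V.a₂ b) - (prodBernoulli u).real (openConn V.a₁ b) =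
      worldQ 0 (V.X u) * (V.R u b 0 2 - V.R u b 0 1) - worldQ 5 (V.X u) * (V.R u b 5 1 - V.R u b 5 2) +
        worldQ 6 (V.X u) * (V.R u b 6 2 - V.R u b 6 1) := V.row_21 hP b hb
  have r31 : (prodBernoulli u).real (openConn V.a₃ b) - (prodBernoulli u).real (openConn V.a₁ b) =
      worldQ 0 (V.X u) * ((V.R u b 0 2 - V.R u b 0 1) + (V.R u b 0 3 - V.R u b 0 2)) -
        worldQ 3 (V.X u) * (V.R u b 3 1 - V.R u b 3 3) + worldQ 6 (V.X u) * (V.R u b 6 2 - V.R u b 6 1) := V.row_31 hP b hb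
  have r32 : (prodBernoulli u).real (openConn V.a₃ b) - (prodBernoulli u).real (openConn V.a₂ b) =
      worldQ 0 (V.X u) * (V.R u b 0 3 - V.R u b 0 2) - worldQ 3 (V.X u) * (V.R u b 3 1 - V.R u b 3 3) +
        worldQ 5 (V.X u) * (V.R u b 5 1 - V.R u b 5 2) := V.row_32 hP b hb
  have hΨ : 0 ≤ blobCoef j' 0 (V.X u) * (V.R u b 0 2 - V.R u b 0 1) + blobCoef j' 1 (V.X u) * (V.R u b 0 3 - V.R u b 0 2) +
      blobCoef j' 2 (V.X u) * (V.R u b 5 1 - V.R u b 5 2) + blobCoef j' 3 (V.X u) * (V.R u b 6 2 - V.R u b 6 1) +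
      blobCoef j' 4 (V.X u) * (V.R u b 3 1 - V.R u b 3 3) := by
    rcases hj' with rfl | rfl | rfl
    · exact blob_free_j1 (V.X u) hx _ _ _ _ _ cα cβ cδ
    · have h1 := hrow V.a₁ ha₁
      change (prodBernoulli u).real (openConn V.a₂ b) ≤ _ at h1
      exact blob_free_j2 (V.X u) hx _ _ _ _ _ cα cβ cγ cδ (by linarith)
    · have h1 := hrow V.a₁ ha₁; have h2 := hrow V.a₂ ha₂
      change (prodBernoulli u).real (openConn V.a₃ b) ≤ _ at h1 h2
      exact blob_free_j3 (V.X u) hx _ _ _ _ _ cα cβ cδ cε (by linarith) (by linarith)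
  rw [← hT] at hΨ
  linarith

end Verts

/-- **The blob kernel, unbundled** (style of `gm_grandchild_row`): three pendant stars `x,y,z` over the relays `a₁,a₂,a₃` (labelled by core
reliability) with arbitrary inner pairs, `j` loneliest in `u`; the goodness functional of `x` in `u[xz ↦ 1][xy ↦ 1]` at `j` is `≥ 0`. [this work] -/
theorem blob_key_row (u : Sym2 (Fin n) → unitInterval) (A : Finset (Fin n)) (hA : A.Nonempty)
    (x y z b a₁ a₂ a₃ j : Fin n) (hAeq : A = {a₁, a₂, a₃}) (h12 : a₁ ≠ a₂) (h13 : a₁ ≠ a₃) (h23 : a₂ ≠ a₃)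
    (hxy : x ≠ y) (hxz : x ≠ z) (hyz : y ≠ z) (hx : x ∉ A) (hy : y ∉ A) (hz : z ∉ A) (hbx : b ≠ x) (hby : b ≠ y) (hbz : b ≠ z)
    (hjA : j ∈ A)
    (hxN : ∀ t : Fin n, t ∉ A → t ≠ y → t ≠ z → u s(x, t) = 0)
    (hyN : ∀ t : Fin n, t ∉ A → t ≠ x → t ≠ z → u s(y, t) = 0)
    (hzN : ∀ t : Fin n, t ∉ A → t ≠ x → t ≠ y → u s(z, t) = 0)
    (K : Sym2 (Fin n) → unitInterval) (hK : K = fun e => if x ∈ e then 0 else if y ∈ e then 0 else if z ∈ e then 0 else u e)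
    (hs12 : (prodBernoulli K).real (openConn a₁ b) ≤ (prodBernoulli K).real (openConn a₂ b))
    (hs23 : (prodBernoulli K).real (openConn a₂ b) ≤ (prodBernoulli K).real (openConn a₃ b))
    (hrow : ∀ a ∈ A, (prodBernoulli u).real (openConn j b) ≤ (prodBernoulli u).real (openConn a b)) :
    (prodBernoulli (Function.update (Function.update u s(x, z) 1) s(x, y) 1)).real (openConn j b) ≤
      (prodBernoulli (Function.update (Function.update u s(x, z) 1) s(x, y) 1)).real (openConn x b) +
        ∑ W ∈ nullSets A, (prodBernoulli (Function.update (Function.update u s(x, z) 1) s(x, y) 1)).real (clusterIs x W) *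
          A.inf' hA (fun a' => (prodBernoulli (Function.update (Function.update u s(x, z) 1) s(x, y) 1)).real
            (openConnIn ((↑W : Set (Fin n))ᶜ) a' b)) := by
  have hxa : x ≠ a₁ ∧ x ≠ a₂ ∧ x ≠ a₃ := by refine ⟨?_, ?_, ?_⟩ <;> rintro rfl <;> simp [hAeq] at hx
  have hya : y ≠ a₁ ∧ y ≠ a₂ ∧ y ≠ a₃ := by refine ⟨?_, ?_, ?_⟩ <;> rintro rfl <;> simp [hAeq] at hy
  have hza : z ≠ a₁ ∧ z ≠ a₂ ∧ z ≠ a₃ := by refine ⟨?_, ?_, ?_⟩ <;> rintro rfl <;> simp [hAeq] at hz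
  let V : Verts n := ⟨x, y, z, a₁, a₂, a₃, hxy, hxz, hyz, hxa.1, hxa.2.1, hxa.2.2, hya.1, hya.2.1, hya.2.2, hza.1, hza.2.1, hza.2.2,
    h12, h13, h23⟩
  have hmemA : ∀ t, t ∉ A ↔ (t ≠ a₁ ∧ t ≠ a₂ ∧ t ≠ a₃) := fun t => by simp [hAeq]
  have hP : V.Pendant u :=
    ⟨fun t h1 h2 h3 h4 h5 => hxN t ((hmemA t).2 ⟨h1, h2, h3⟩) h4 h5,
     fun t h1 h2 h3 h4 h5 => hyN t ((hmemA t).2 ⟨h1, h2, h3⟩) h4 h5,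
     fun t h1 h2 h3 h4 h5 => hzN t ((hmemA t).2 ⟨h1, h2, h3⟩) h4 h5⟩
  have hcore : V.core u = K := by rw [hK]; rfl
  have hb : b ∉ ({V.x, V.y, V.z} : Finset (Fin n)) := by
    show b ∉ ({x, y, z} : Finset (Fin n)); simp [hbx, hby, hbz]
  subst hAeq
  have h := V.blob_key hP b hb hA (by rw [hcore]; exact hs12) (by rw [hcore]; exact hs23) j hjA hrow
  simpa using h

open UpsetExchange RelayNbhd in
/-- **The observer with three children is good** (`|A| = 3`; the last observer side of ≤ 4 vertices).  `o, x, y, z ∉ A = {a₁,a₂,a₃}` distinct;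
the pairs at `o` go to `A ∪ {x,y,z}` (relay hairs allowed: the stars meeting `A` are Lemma 5's inside `knGood_of_starNeed`), at `x` to `A ∪ {o,y,z}`,
at `y` to `A ∪ {o,x,z}`, at `z` to `A ∪ {o,x,y}` (all weights arbitrary); loop at `o` zero; `b ∉ {o,x,y,z}`.  Then `KNGood w A hA o b`. [this work] -/
theorem knGood_threeChildren (w : Sym2 (Fin n) → unitInterval) (A : Finset (Fin n)) (hA : A.Nonempty)
    (o x y z b a₁ a₂ a₃ : Fin n) (hAeq : A = {a₁, a₂, a₃}) (h12 : a₁ ≠ a₂) (h13 : a₁ ≠ a₃) (h23 : a₂ ≠ a₃)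
    (ho : o ∉ A) (hx : x ∉ A) (hy : y ∉ A) (hz : z ∉ A) (hxo : x ≠ o) (hyo : y ≠ o) (hzo : z ≠ o) (hxy : x ≠ y) (hxz : x ≠ z)
    (hyz : y ≠ z) (hbo : b ≠ o) (hbx : b ≠ x) (hby : b ≠ y) (hbz : b ≠ z) (hloop : w s(o, o) = 0)
    (hoN : ∀ v : Fin n, v ≠ o → v ∉ A → v ≠ x → v ≠ y → v ≠ z → w s(o, v) = 0)
    (hxN : ∀ t : Fin n, t ∉ A → t ≠ o → t ≠ y → t ≠ z → w s(x, t) = 0)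
    (hyN : ∀ t : Fin n, t ∉ A → t ≠ o → t ≠ x → t ≠ z → w s(y, t) = 0)
    (hzN : ∀ t : Fin n, t ∉ A → t ≠ o → t ≠ x → t ≠ y → w s(z, t) = 0) :
    KNGood w A hA o b := by
  refine knGood_threeChildren_of_blobKey w A hA o x y z b a₁ a₂ a₃ hAeq h12 h13 h23 ho hx hy hz hxo hyo hzo hxy hxz hyz hbo hbx hby hbz
    hloop hoN hxN hyN hzN fun a₀ ha₀ hmin => ?_
  have hao : a₀ ≠ o := fun h => ho (h ▸ ha₀)
  -- corner (1,1,1): pass to the contracted graph `w⁰[xz ↦ 1][xy ↦ 1]`, observer `x`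
  have e := agood_wzero_glue_three w A hA o x y z a₀ b ho hxo hyo hzo hxy hxz hyz ha₀ hbo hloop
  set w0 := pinW w {e : Sym2 (Fin n) | o ∈ e ∧ ¬ e.IsDiag} ∅ with hw0
  obtain ⟨hxN0, hyN0, hzN0⟩ := pendant_wzero w A o x y z hxo hyo hzo hxN hyN hzN
  -- sort the relays by their reliability in the core
  set K : Sym2 (Fin n) → unitInterval := fun f => if x ∈ f then 0 else if y ∈ f then 0 else if z ∈ f then 0 else w0 f with hK
  obtain ⟨b₁, b₂, b₃, hP3, hb12, hb13, hb23, hs12, hs23⟩ :=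
    exists_sorted_three (fun a => (prodBernoulli K).real (openConn a b)) a₁ a₂ a₃ h12 h13 h23
  have hAeq' : A = {b₁, b₂, b₃} := hAeq.trans hP3
  -- loneliness of `a₀` in `w⁰ = G − o` (loops are invisible)
  have hw0r : ∀ a : Fin n, a ≠ o → (prodBernoulli w0).real (openConn a b) = (prodBernoulli w).real (openConnIn ({o}ᶜ : Set (Fin n)) a b) := by
    intro a ha'
    rw [← restrW_real_openConn w o ha' b]
    refine real_openConn_congr_offDiag _ _ (fun f hf => ?_) a b
    induction f using Sym2.ind with
    | h p q =>
      have hpq : p ≠ q := fun h => hf (Sym2.mk_isDiag_iff.2 h)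
      by_cases hof : o ∈ s(p, q)
      · rw [hw0, pinW_apply_of_mem_of_not_mem w (F := {e : Sym2 (Fin n) | o ∈ e ∧ ¬ e.IsDiag}) ⟨hof, hf⟩ (Set.notMem_empty _),
          restrW_apply_of_not_mem]
        intro hm
        obtain ⟨hp, hq, -⟩ := mk_mem_wireSet_iff.1 hm
        rcases Sym2.mem_iff.1 hof with h | h
        · exact (Set.mem_compl_singleton_iff.1 hp) h.symm
        · exact (Set.mem_compl_singleton_iff.1 hq) h.symm
      · rw [hw0, pinW_apply_of_not_mem w ∅ (fun h => hof h.1), restrW_apply_of_mem]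
        refine mk_mem_wireSet_iff.2 ⟨?_, ?_, hpq⟩
        · exact Set.mem_compl_singleton_iff.2 (fun h => hof (h ▸ Sym2.mem_mk_left _ _))
        · exact Set.mem_compl_singleton_iff.2 (fun h => hof (h ▸ Sym2.mem_mk_right _ _))
  have hrow : ∀ a ∈ A, (prodBernoulli w0).real (openConn a₀ b) ≤ (prodBernoulli w0).real (openConn a b) := by
    intro a ha
    rw [hw0r a₀ hao, hw0r a (fun h => ho (h ▸ ha))]
    exact hmin a ha
  have key := blob_key_row w0 A hA x y z b b₁ b₂ b₃ a₀ hAeq' hb12 hb13 hb23 hxy hxz hyz hx hy hz hbx hby hbz ha₀ hxN0 hyN0 hzN0 K hK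
    hs12 hs23 hrow
  rw [hw0] at key
  linarith [key, e]

end KNGoodGMgc

end Summit.CriticalPhenomena.PercolationContinuityZ3.Theorems

end
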